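import Mathlib.MeasureTheory.Function.Jacobian
import Mathlib.MeasureTheory.Measure.Lebesgue.Complex
import Mathlib.LinearAlgebra.Complex.Determinant
import Mathlib.Analysis.Complex.Basic
import Literature.Barriers.CriticalPhenomena.EmbeddingModulusUniqueness
import HarnessLib

/-!
# Pulling back the Dirichlet energy through a shear composed with conformal maps

Topic `Literature/Probability/RandomPlanarGeometry`; the change-of-variables half of the
variational proof of `ShearCrossRatioAnalytic` (`ShearModulusAnalytic.lean`: the conformal
modulus of Beffara's sheared quad `φ_α R'` is real-analytic in `α`). Everything is PROVED.

If `Φ = g ∘ φ_α ∘ f` with `f`, `g` conformal and `φ_α` Beffara's shear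
(`Literature.Barriers.CriticalPhenomena.moduliShear α`, `φ_α (x + iy) = x + α y`, `α = a + ib`,
`b > 0`), and `U ∘ Φ = u`, then the Dirichlet energy density of `U` pulled back to the domain of
`u` is
`|det DΦ| · |∇U|²∘Φ = ((a² + b²) W₁² - 2a W₁W₂ + W₂²) / (b |h|²)`,
`W₁ + iW₂ = h · (u_x + i u_y)`, `h = f′` (`abs_det_mul_gradSq_eq_shearDensity`): the conformal
factor `g′` DROPS OUT, so the pulled-back energy is an explicit combination of three fixed
quadratic forms with coefficients `(a² + b²)/b, -2a/b, 1/b` real-analytic in `α` — the key to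
the analytic dependence of the modulus on the shear. With Mathlib's change-of-variables formula
(`MeasureTheory.integral_image_eq_integral_abs_det_fderiv_smul`) this gives the energy identity
`∫_{Φ(s)} |∇U|² = ∫_s ((a²+b²) W₁² - 2a W₁W₂ + W₂²)/(b |h|²)`
(`setIntegral_image_gradSq_eq`), the conformal/quasiconformal transformation rule of the
Dirichlet integral (Ahlfors, *Lectures on Quasiconformal Mappings* (1966), Ch. I §B; Lehto–Virtanen
(1973), Ch. I §5.2).

## Mathlib

USED: `LinearMap.det_toMatrix`, `Matrix.det_fin_two`, `Complex.basisOneI`,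
`MeasureTheory.integral_image_eq_integral_abs_det_fderiv_smul`,
`MeasureTheory.integrableOn_image_iff_integrableOn_abs_det_fderiv_smul`.

## References

* L. V. Ahlfors, *Lectures on Quasiconformal Mappings*, Van Nostrand (1966), Ch. I §B.
* O. Lehto, K. I. Virtanen, *Quasiconformal Mappings in the Plane*, Springer (1973), Ch. I §5.
  [folklore]
-/

noncomputable section

open Set MeasureTheory Complex
open scoped Topology

namespace Literature.Probability.RandomPlanarGeometry

open Literature.Barriers.CriticalPhenomena (moduliShear)

namespace DirichletPullback

/-! ### Real-linear maps of `ℂ`: determinant and the transformation of `|∇U|²` -/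

/-- The determinant of a real-linear self-map `A` of `ℂ` in terms of `A 1` and `A i`:
`det A = re(A 1) im(A i) - re(A i) im(A 1)`. [folklore] -/
theorem det_eq (A : ℂ →L[ℝ] ℂ) :
    A.det = (A 1).re * (A I).im - (A I).re * (A 1).im := by
  rw [ContinuousLinearMap.det, ← LinearMap.det_toMatrix basisOneI, Matrix.det_fin_two]
  simp [LinearMap.toMatrix_apply]

/-- A real-linear functional on `ℂ` is determined by its values at `1` and `i`:
`σ v = σ 1 · re v + σ i · im v`. [folklore] -/
theorem realFunctional_apply (σ : ℂ →L[ℝ] ℝ) (v : ℂ) : σ v = σ 1 * v.re + σ I * v.im := by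
  conv_lhs => rw [← re_add_im v]
  rw [map_add]
  have h1 : σ ((v.re : ℂ)) = v.re * σ 1 := by
    rw [show ((v.re : ℝ) : ℂ) = (v.re : ℝ) • (1 : ℂ) by simp, map_smul, smul_eq_mul]
  have h2 : σ ((v.im : ℂ) * I) = v.im * σ I := by
    rw [show ((v.im : ℝ) : ℂ) * I = (v.im : ℝ) • I by simp, map_smul, smul_eq_mul]
  rw [h1, h2]; ring

/-- **Transformation of the squared gradient under a real-linear change of variables.** If the
covectors `ρ, σ` satisfy `ρ = σ ∘ A` (chain rule for `U ∘ Φ = u`, `A = DΦ`, `σ = DU`, `ρ = Du`)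
then `|det A| · (σ(1)² + σ(i)²) = (|A i|² ρ(1)² - 2⟨A 1, A i⟩ ρ(1)ρ(i) + |A 1|² ρ(i)²) / |det A|`
(`det A ≠ 0`). [folklore] -/
theorem abs_det_mul_gradSq_eq (A : ℂ →L[ℝ] ℂ) (ρ σ : ℂ →L[ℝ] ℝ) (hρ : ∀ v, ρ v = σ (A v))
    (hdet : A.det ≠ 0) :
    |A.det| * (σ 1 ^ 2 + σ I ^ 2) =
      (((A I).re ^ 2 + (A I).im ^ 2) * ρ 1 ^ 2
        - 2 * ((A 1).re * (A I).re + (A 1).im * (A I).im) * ρ 1 * ρ I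
        + ((A 1).re ^ 2 + (A 1).im ^ 2) * ρ I ^ 2) / |A.det| := by
  have habs : |A.det| ≠ 0 := abs_ne_zero.2 hdet
  rw [eq_div_iff habs]
  have h1 : ρ 1 = σ 1 * (A 1).re + σ I * (A 1).im := by rw [hρ, realFunctional_apply]
  have hI : ρ I = σ 1 * (A I).re + σ I * (A I).im := by rw [hρ, realFunctional_apply]
  have hsq : |A.det| * |A.det| = A.det ^ 2 := by rw [← sq, sq_abs]
  calc |A.det| * (σ 1 ^ 2 + σ I ^ 2) * |A.det| = A.det ^ 2 * (σ 1 ^ 2 + σ I ^ 2) := by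
        rw [mul_comm, ← mul_assoc, hsq]
    _ = _ := by rw [det_eq, h1, hI]; ring

/-! ### The derivative of `g ∘ φ_α ∘ f`: the conformal factor of `g` drops out -/

/-- The determinant of `v ↦ γ · φ_α (h v)` is `|γ|² · im α · |h|²`. [folklore] -/
theorem det_eq_of_shear {A : ℂ →L[ℝ] ℂ} {α γ h : ℂ} (hA1 : A 1 = γ * moduliShear α h)
    (hAI : A I = γ * moduliShear α (I * h)) :
    A.det = normSq γ * α.im * normSq h := by
  rw [det_eq, hA1, hAI]
  simp only [moduliShear, mul_re, mul_im, add_re, add_im, ofReal_re, ofReal_im, I_re, I_im,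
    normSq_apply]
  ring

/-- **The pulled-back energy density through `g ∘ φ_α ∘ f`.** If `A = DΦ` has `A 1 = γ φ_α(h)`,
`A i = γ φ_α(ih)` (`γ = g′ ≠ 0`, `h = f′ ≠ 0`, `im α > 0`) and `ρ = σ ∘ A`, then
`|det A| · (σ(1)² + σ(i)²) = ((|α|²) W₁² - 2 re α · W₁W₂ + W₂²) / (im α · |h|²)` with
`W₁ = re h · ρ(1) - im h · ρ(i)`, `W₂ = im h · ρ(1) + re h · ρ(i)`; the factor `γ` does not
appear. [folklore] -/
theorem abs_det_mul_gradSq_eq_shearDensity {A : ℂ →L[ℝ] ℂ} {α γ h : ℂ} (hα : 0 < α.im)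
    (hγ : γ ≠ 0) (hh : h ≠ 0) (hA1 : A 1 = γ * moduliShear α h)
    (hAI : A I = γ * moduliShear α (I * h)) (ρ σ : ℂ →L[ℝ] ℝ) (hρ : ∀ v, ρ v = σ (A v)) :
    |A.det| * (σ 1 ^ 2 + σ I ^ 2) =
      (normSq α * (h.re * ρ 1 - h.im * ρ I) ^ 2
        - 2 * α.re * (h.re * ρ 1 - h.im * ρ I) * (h.im * ρ 1 + h.re * ρ I)
        + (h.im * ρ 1 + h.re * ρ I) ^ 2) / (α.im * normSq h) := by
  have hdetval := det_eq_of_shear hA1 hAI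
  have hγ' : 0 < normSq γ := normSq_pos.2 hγ
  have hh' : 0 < normSq h := normSq_pos.2 hh
  have hdetpos : 0 < A.det := by rw [hdetval]; positivity
  rw [abs_det_mul_gradSq_eq A ρ σ hρ hdetpos.ne', abs_of_pos hdetpos, hdetval, hA1, hAI]
  rw [div_eq_div_iff (by positivity) (by positivity)]
  simp only [moduliShear, mul_re, mul_im, add_re, add_im, ofReal_re, ofReal_im, I_re, I_im,
    normSq_apply]
  ring

/-- **Upper bound for the pulled-back density**: it is at most `(|α|² + 1)/im α · (p² + q²)`
(`(|α|²+1)(X²+Y²) - (|α|²X² - 2 re α XY + Y²) = (X + re α Y)² + (im α)² Y² ≥ 0`). [folklore] -/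
theorem shearDensity_le {α h : ℂ} (hα : 0 < α.im) (hh : h ≠ 0) (p q : ℝ) :
    (normSq α * (h.re * p - h.im * q) ^ 2
        - 2 * α.re * (h.re * p - h.im * q) * (h.im * p + h.re * q)
        + (h.im * p + h.re * q) ^ 2) / (α.im * normSq h)
      ≤ ((normSq α + 1) / α.im) * (p ^ 2 + q ^ 2) := by
  have hh' : 0 < normSq h := normSq_pos.2 hh
  set X := h.re * p - h.im * q with hX
  set Y := h.im * p + h.re * q with hY
  have hrot : X ^ 2 + Y ^ 2 = normSq h * (p ^ 2 + q ^ 2) := by rw [hX, hY, normSq_apply]; ring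
  have hns : normSq α = α.re ^ 2 + α.im ^ 2 := by rw [normSq_apply]; ring
  have key : normSq α * X ^ 2 - 2 * α.re * X * Y + Y ^ 2 ≤ (normSq α + 1) * (X ^ 2 + Y ^ 2) := by
    rw [hns]
    nlinarith [sq_nonneg (X + α.re * Y), sq_nonneg (α.im * Y)]
  rw [div_le_iff₀ (mul_pos hα hh')]
  calc normSq α * X ^ 2 - 2 * α.re * X * Y + Y ^ 2 ≤ (normSq α + 1) * (X ^ 2 + Y ^ 2) := key
    _ = (normSq α + 1) / α.im * (p ^ 2 + q ^ 2) * (α.im * normSq h) := by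
        rw [hrot]; field_simp

/-- **Coercivity of the pulled-back density**: it is at least `im α/(|α|² + 1) · (p² + q²)`
(`(|α|²+1)(|α|²X² - 2 re α XY + Y²) - (im α)²(X²+Y²) = (|α|² X - re α Y)² + (re α X - Y)² ≥ 0`).
[folklore] -/
theorem le_shearDensity {α h : ℂ} (hα : 0 < α.im) (hh : h ≠ 0) (p q : ℝ) :
    (α.im / (normSq α + 1)) * (p ^ 2 + q ^ 2) ≤
      (normSq α * (h.re * p - h.im * q) ^ 2
        - 2 * α.re * (h.re * p - h.im * q) * (h.im * p + h.re * q)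
        + (h.im * p + h.re * q) ^ 2) / (α.im * normSq h) := by
  have hh' : 0 < normSq h := normSq_pos.2 hh
  have hN : 0 < normSq α + 1 := by linarith [normSq_nonneg α]
  set X := h.re * p - h.im * q with hX
  set Y := h.im * p + h.re * q with hY
  have hrot : X ^ 2 + Y ^ 2 = normSq h * (p ^ 2 + q ^ 2) := by rw [hX, hY, normSq_apply]; ring
  have hns : normSq α = α.re ^ 2 + α.im ^ 2 := by rw [normSq_apply]; ring
  have key : α.im ^ 2 * (X ^ 2 + Y ^ 2) ≤
      (normSq α + 1) * (normSq α * X ^ 2 - 2 * α.re * X * Y + Y ^ 2) := by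
    rw [hns]
    nlinarith [sq_nonneg ((α.re ^ 2 + α.im ^ 2) * X - α.re * Y), sq_nonneg (α.re * X - Y)]
  have hpos : 0 < α.im * normSq h := mul_pos hα hh'
  have hQ : α.im / (normSq α + 1) * (p ^ 2 + q ^ 2) =
      (α.im ^ 2 * (X ^ 2 + Y ^ 2)) / ((normSq α + 1) * (α.im * normSq h)) := by
    rw [hrot]; field_simp
  rw [hQ, div_le_div_iff₀ (mul_pos hN hpos) hpos]
  calc α.im ^ 2 * (X ^ 2 + Y ^ 2) * (α.im * normSq h)
      ≤ (normSq α + 1) * (normSq α * X ^ 2 - 2 * α.re * X * Y + Y ^ 2) * (α.im * normSq h) :=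
        mul_le_mul_of_nonneg_right key hpos.le
    _ = _ := by ring

/-! ### The energy identity -/

/-- **Chain rule in covector form**: if `U ∘ Φ = u` near `z`, `Φ` has real derivative `A` at
`z` and `U` is real-differentiable at `Φ z`, then `Du(z) = DU(Φ z) ∘ A`. [folklore] -/
theorem fderiv_comp_apply_eq {U u : ℂ → ℝ} {Φ : ℂ → ℂ} {A : ℂ →L[ℝ] ℂ} {z : ℂ} {s : Set ℂ}
    (hs : IsOpen s) (hz : z ∈ s) (hΦ : HasFDerivAt Φ A z) (hU : DifferentiableAt ℝ U (Φ z))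
    (hUu : EqOn (U ∘ Φ) u s) (v : ℂ) : fderiv ℝ u z v = fderiv ℝ U (Φ z) (A v) := by
  have h1 : HasFDerivAt (U ∘ Φ) ((fderiv ℝ U (Φ z)).comp A) z := hU.hasFDerivAt.comp z hΦ
  have h2 : HasFDerivAt u ((fderiv ℝ U (Φ z)).comp A) z :=
    h1.congr_of_eventuallyEq (by
      filter_upwards [hs.mem_nhds hz] with w hw
      exact (hUu hw).symm)
  rw [h2.fderiv, ContinuousLinearMap.comp_apply]

/-- **The Dirichlet energy pulled back through `Φ = g ∘ φ_α ∘ f`.** Let `s` be open, `Φ`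
injective on `s` with real derivative `A z` at every `z ∈ s` of the shear form
`A z 1 = γ z · φ_α (h z)`, `A z i = γ z · φ_α (i h z)` (`γ, h ≠ 0` on `s`, `im α > 0`), and let
`U` be real-differentiable on `Φ(s)` with `U ∘ Φ = u` on `s`. Then
`∫_{Φ(s)} (U_x² + U_y²) = ∫_s ((|α|²) W₁² - 2 re α W₁W₂ + W₂²)/(im α |h|²)`,
`W₁ = re h · u_x - im h · u_y`, `W₂ = im h · u_x + re h · u_y` (change of variables + the
pointwise identity `abs_det_mul_gradSq_eq_shearDensity`). Ahlfors (1966), Ch. I §B.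
[folklore] -/
theorem setIntegral_image_gradSq_eq {s : Set ℂ} (hs : IsOpen s) {Φ γ h : ℂ → ℂ}
    {A : ℂ → ℂ →L[ℝ] ℂ} {α : ℂ} (hα : 0 < α.im) (hΦ : ∀ z ∈ s, HasFDerivAt Φ (A z) z)
    (hinj : InjOn Φ s) (hA1 : ∀ z ∈ s, A z 1 = γ z * moduliShear α (h z))
    (hAI : ∀ z ∈ s, A z I = γ z * moduliShear α (I * h z)) (hγ : ∀ z ∈ s, γ z ≠ 0)
    (hh : ∀ z ∈ s, h z ≠ 0) {U u : ℂ → ℝ} (hU : ∀ z ∈ s, DifferentiableAt ℝ U (Φ z))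
    (hUu : EqOn (U ∘ Φ) u s) :
    ∫ w in Φ '' s, (fderiv ℝ U w 1 ^ 2 + fderiv ℝ U w I ^ 2) =
      ∫ z in s, (normSq α * ((h z).re * fderiv ℝ u z 1 - (h z).im * fderiv ℝ u z I) ^ 2
        - 2 * α.re * ((h z).re * fderiv ℝ u z 1 - (h z).im * fderiv ℝ u z I)
          * ((h z).im * fderiv ℝ u z 1 + (h z).re * fderiv ℝ u z I)
        + ((h z).im * fderiv ℝ u z 1 + (h z).re * fderiv ℝ u z I) ^ 2)
        / (α.im * normSq (h z)) := by
  rw [integral_image_eq_integral_abs_det_fderiv_smul volume hs.measurableSet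
    (fun z hz => (hΦ z hz).hasFDerivWithinAt) hinj]
  refine setIntegral_congr_fun hs.measurableSet fun z hz => ?_
  rw [smul_eq_mul]
  exact abs_det_mul_gradSq_eq_shearDensity hα (hγ z hz) (hh z hz) (hA1 z hz) (hAI z hz)
    (fderiv ℝ u z) (fderiv ℝ U (Φ z)) (fderiv_comp_apply_eq hs hz (hΦ z hz) (hU z hz) hUu)

/-- **Integrability transfers** under the same hypotheses: `|∇U|²` is integrable on `Φ(s)` iff
the pulled-back density is integrable on `s`. [folklore] -/
theorem integrableOn_image_gradSq_iff {s : Set ℂ} (hs : IsOpen s) {Φ γ h : ℂ → ℂ}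
    {A : ℂ → ℂ →L[ℝ] ℂ} {α : ℂ} (hα : 0 < α.im) (hΦ : ∀ z ∈ s, HasFDerivAt Φ (A z) z)
    (hinj : InjOn Φ s) (hA1 : ∀ z ∈ s, A z 1 = γ z * moduliShear α (h z))
    (hAI : ∀ z ∈ s, A z I = γ z * moduliShear α (I * h z)) (hγ : ∀ z ∈ s, γ z ≠ 0)
    (hh : ∀ z ∈ s, h z ≠ 0) {U u : ℂ → ℝ} (hU : ∀ z ∈ s, DifferentiableAt ℝ U (Φ z))
    (hUu : EqOn (U ∘ Φ) u s) :
    IntegrableOn (fun w => fderiv ℝ U w 1 ^ 2 + fderiv ℝ U w I ^ 2) (Φ '' s) ↔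
      IntegrableOn (fun z =>
        (normSq α * ((h z).re * fderiv ℝ u z 1 - (h z).im * fderiv ℝ u z I) ^ 2
        - 2 * α.re * ((h z).re * fderiv ℝ u z 1 - (h z).im * fderiv ℝ u z I)
          * ((h z).im * fderiv ℝ u z 1 + (h z).re * fderiv ℝ u z I)
        + ((h z).im * fderiv ℝ u z 1 + (h z).re * fderiv ℝ u z I) ^ 2)
        / (α.im * normSq (h z))) s := by
  rw [integrableOn_image_iff_integrableOn_abs_det_fderiv_smul volume hs.measurableSet
    (fun z hz => (hΦ z hz).hasFDerivWithinAt) hinj]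
  refine integrableOn_congr_fun (fun z hz => ?_) hs.measurableSet
  rw [smul_eq_mul]
  exact abs_det_mul_gradSq_eq_shearDensity hα (hγ z hz) (hh z hz) (hA1 z hz) (hAI z hz)
    (fderiv ℝ u z) (fderiv ℝ U (Φ z)) (fderiv_comp_apply_eq hs hz (hΦ z hz) (hU z hz) hUu)

/-- **Energy comparison.** Under the same hypotheses the pulled-back density lies between
`im α/(|α|²+1) · |∇u|²` and `(|α|²+1)/im α · |∇u|²`; in particular `|∇U|²` is integrable on
`Φ(s)` iff `|∇u|²` is integrable on `s` (given continuity of the gradients for measurability).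
We record the two one-sided consequences used later. [folklore] -/
theorem integrableOn_image_gradSq_of {s : Set ℂ} (hs : IsOpen s) {Φ γ h : ℂ → ℂ}
    {A : ℂ → ℂ →L[ℝ] ℂ} {α : ℂ} (hα : 0 < α.im) (hΦ : ∀ z ∈ s, HasFDerivAt Φ (A z) z)
    (hinj : InjOn Φ s) (hA1 : ∀ z ∈ s, A z 1 = γ z * moduliShear α (h z))
    (hAI : ∀ z ∈ s, A z I = γ z * moduliShear α (I * h z)) (hγ : ∀ z ∈ s, γ z ≠ 0)
    (hh : ∀ z ∈ s, h z ≠ 0) {U u : ℂ → ℝ} (hU : ∀ z ∈ s, DifferentiableAt ℝ U (Φ z))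
    (hUu : EqOn (U ∘ Φ) u s)
    (hmeas : AEStronglyMeasurable (fun z =>
        (normSq α * ((h z).re * fderiv ℝ u z 1 - (h z).im * fderiv ℝ u z I) ^ 2
        - 2 * α.re * ((h z).re * fderiv ℝ u z 1 - (h z).im * fderiv ℝ u z I)
          * ((h z).im * fderiv ℝ u z 1 + (h z).re * fderiv ℝ u z I)
        + ((h z).im * fderiv ℝ u z 1 + (h z).re * fderiv ℝ u z I) ^ 2)
        / (α.im * normSq (h z))) (volume.restrict s))
    (hint : IntegrableOn (fun z => fderiv ℝ u z 1 ^ 2 + fderiv ℝ u z I ^ 2) s) :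
    IntegrableOn (fun w => fderiv ℝ U w 1 ^ 2 + fderiv ℝ U w I ^ 2) (Φ '' s) := by
  rw [integrableOn_image_gradSq_iff hs hα hΦ hinj hA1 hAI hγ hh hU hUu]
  refine Integrable.mono' (hint.const_mul ((normSq α + 1) / α.im)) hmeas ?_
  filter_upwards [ae_restrict_mem hs.measurableSet] with z hz
  rw [Real.norm_eq_abs, abs_of_nonneg]
  · exact shearDensity_le hα (hh z hz) _ _
  · exact le_trans (mul_nonneg (div_nonneg hα.le (by linarith [normSq_nonneg α]))
      (add_nonneg (sq_nonneg _) (sq_nonneg _))) (le_shearDensity hα (hh z hz) _ _)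

/-- Converse comparison: if `|∇U|²` is integrable on `Φ(s)` then `|∇u|²` is integrable on `s`
(coercivity `le_shearDensity`). [folklore] -/
theorem integrableOn_gradSq_of_image {s : Set ℂ} (hs : IsOpen s) {Φ γ h : ℂ → ℂ}
    {A : ℂ → ℂ →L[ℝ] ℂ} {α : ℂ} (hα : 0 < α.im) (hΦ : ∀ z ∈ s, HasFDerivAt Φ (A z) z)
    (hinj : InjOn Φ s) (hA1 : ∀ z ∈ s, A z 1 = γ z * moduliShear α (h z))
    (hAI : ∀ z ∈ s, A z I = γ z * moduliShear α (I * h z)) (hγ : ∀ z ∈ s, γ z ≠ 0)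
    (hh : ∀ z ∈ s, h z ≠ 0) {U u : ℂ → ℝ} (hU : ∀ z ∈ s, DifferentiableAt ℝ U (Φ z))
    (hUu : EqOn (U ∘ Φ) u s)
    (hmeas : AEStronglyMeasurable (fun z => fderiv ℝ u z 1 ^ 2 + fderiv ℝ u z I ^ 2)
      (volume.restrict s))
    (hint : IntegrableOn (fun w => fderiv ℝ U w 1 ^ 2 + fderiv ℝ U w I ^ 2) (Φ '' s)) :
    IntegrableOn (fun z => fderiv ℝ u z 1 ^ 2 + fderiv ℝ u z I ^ 2) s := by
  rw [integrableOn_image_gradSq_iff hs hα hΦ hinj hA1 hAI hγ hh hU hUu] at hint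
  have hN : 0 < normSq α + 1 := by linarith [normSq_nonneg α]
  have h1 := hint.const_mul ((normSq α + 1) / α.im)
  refine Integrable.mono' h1 hmeas ?_
  filter_upwards [ae_restrict_mem hs.measurableSet] with z hz
  rw [Real.norm_eq_abs, abs_of_nonneg (add_nonneg (sq_nonneg _) (sq_nonneg _))]
  have h := le_shearDensity hα (hh z hz) (fderiv ℝ u z 1) (fderiv ℝ u z I)
  have hc : 0 < α.im / (normSq α + 1) := div_pos hα hN
  calc fderiv ℝ u z 1 ^ 2 + fderiv ℝ u z I ^ 2
      = ((normSq α + 1) / α.im) * ((α.im / (normSq α + 1)) *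
          (fderiv ℝ u z 1 ^ 2 + fderiv ℝ u z I ^ 2)) := by
        field_simp
    _ ≤ _ := mul_le_mul_of_nonneg_left h (div_nonneg hN.le hα.le)

end DirichletPullback

end Literature.Probability.RandomPlanarGeometry
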